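import Literature.ModelTheory.ExponentialFields.SemialgebraicCertifiedCuts
import Literature.ModelTheory.ExponentialFields.SemialgebraicThickLadders
import HarnessLib

/-!
# Certified mechanisms: ladders and lenses certify their pieces on open sets

Topic `Literature/ModelTheory/ExponentialFields` — block B2d₁ of the proof of the
`C¹`-triangulation theorem for compact semialgebraic sets
(`Literature.ModelTheory.ExponentialFields.OhmotoShiota2017_c1Triangulation`, statement of
[OhmotoShiota2017, Thm. 1.1]) along the proof of [Pawlucki2024], specialized to `p = 1`.

The two mechanisms of the proof of [Pawlucki2024, Prop. 2.5] in certified form (block B2d₀):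

* **thick ladders** (block B2c₁): on `U_B` the translated pieces `(c_ν, c_{ν+1})` lie in
  `V (jb ν)` and the end bits `(γ, c₀)`, `(c_M, δ)` in `V (jb 0)`, `V (jb (M-1))` — unconditionally,
  whence certificates with domain `U_B` and `CValid` on `U_B` (`LadderData.cvalid_of_mem_UB`);
* **lenses** (blocks B2b, B2c₂): `(bm_i, bp_i)` and `(tm_i, tp_i)` lie in their members on all of
  `ℝᵐ`; the certified assembly `LensFamilies.cvalid_of_free` mirrors `rcValid_of_free`.

No named facts are introduced (D-0026).

## References

* [Pawlucki2024] W. Pawłucki, *Strict `C^p`-triangulations — a new approach to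
  desingularization*, J. Eur. Math. Soc. 26 (2024), 3863–3909, Prop. 2.5.
* [OhmotoShiota2017] T. Ohmoto, M. Shiota, *`C¹`-triangulations of semialgebraic sets*,
  J. Topology 10 (2017), Thm. 1.1 (statement only).
-/

noncomputable section

open Set Filter Metric
open _root_.Topology

namespace Literature.ModelTheory.ExponentialFields

open Literature.NumberTheory.Transcendental (IsSemialgebraicFunOn IsSemialgebraicMapOn)

/-! ### Ladder certificates -/

section LadderCerts

variable {m k q : ℕ}

namespace LadderData

variable {L : LadderData m k q} (H : L.Hyp)
include H

/-- The certificate of the `ν`-th translated piece. [cite: Pawlucki2024, p. 3872] -/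
def certMid (L : LadderData m k q) (ν : ℕ) : Cert m q := ⟨L.cut ν, L.cut (ν + 1), L.jb ν, L.UB⟩

/-- The certificate of the bottom end bit. [cite: Pawlucki2024, p. 3872] -/
def certBot (L : LadderData m k q) : Cert m q := ⟨L.γ, L.cut 0, L.jb 0, L.UB⟩

/-- The certificate of the top end bit. [cite: Pawlucki2024, p. 3872] -/
def certTop (L : LadderData m k q) : Cert m q := ⟨L.cut L.M, L.δ, L.jb (L.M - 1), L.UB⟩

/-- The ladder certificates. [cite: Pawlucki2024, p. 3872] -/
def certs (L : LadderData m k q) : Set (Cert m q) :=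
  {κ | κ = L.certBot ∨ κ = L.certTop ∨ ∃ ν < L.M, κ = L.certMid ν}

omit H in
/-- The ladder certificates form a finite set. [cite: Pawlucki2024, p. 3872] -/
theorem certs_finite : L.certs.Finite := by
  have h : L.certs ⊆ {L.certBot, L.certTop} ∪ (fun ν => L.certMid ν) '' Iio L.M := by
    rintro κ (rfl | rfl | ⟨ν, hν, rfl⟩)
    · exact Or.inl (Or.inl rfl)
    · exact Or.inl (Or.inr rfl)
    · exact Or.inr ⟨ν, hν, rfl⟩
  exact ((Set.toFinite _).union ((finite_Iio _).image _)).subset h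

/-- **The translated pieces are certified on `U_B`.** [cite: Pawlucki2024, p. 3872] -/
theorem snoc_mem_V_mid {ν : ℕ} (hν : ν < L.M) {x : Fin m → ℝ} (hx : x ∈ L.UB) {t : ℝ}
    (ht : t ∈ Icc (L.cut ν x) (L.cut (ν + 1) x)) : (Fin.snoc x t : Fin (m + 1) → ℝ) ∈ L.V (L.jb ν) := by
  have hxC := hx.1
  have hy : L.proj x ∈ L.B := ChartData.proj_mem H.toHyp hxC
  set y := L.proj x with hy_def
  have hdxy : dist y x = L.tdist x := by unfold ChartData.tdist; rw [dist_comm]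
  rw [cut_eq_of_mem_UB H hx ν, cut_eq_of_mem_UB H hx (ν + 1)] at ht
  refine mem_V_of_dist_lt (L := L) (z := Fin.snoc y t) ?_
  rw [dist_snoc_snoc, dist_self, max_eq_left dist_nonneg, hdxy]
  calc L.tdist x < L.r₁ y := hx.2.2.2.1
    _ ≤ L.Gp ν y := by linarith [two_r₁_le (L := L) y hν, (r₁_pos H hy).le]
    _ ≤ L.GV (L.jb ν) (Fin.snoc y t) := Gp_le y ν ht

/-- **The bottom end bit is certified on `U_B`.** [cite: Pawlucki2024, p. 3872] -/
theorem snoc_mem_V_bot {x : Fin m → ℝ} (hx : x ∈ L.UB) {t : ℝ} (ht : t ∈ Ioc (L.γ x) (L.cut 0 x)) :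
    (Fin.snoc x t : Fin (m + 1) → ℝ) ∈ L.V (L.jb 0) := by
  have hxC := hx.1
  have hy : L.proj x ∈ L.B := ChartData.proj_mem H.toHyp hxC
  set y := L.proj x with hy_def
  have hdxy : dist y x = L.tdist x := by unfold ChartData.tdist; rw [dist_comm]
  rw [cut_eq_of_mem_UB H hx 0, H.ψ_zero y hy] at ht
  refine mem_V_of_dist_lt (L := L) (z := Fin.snoc y (L.γ y)) ?_
  rw [dist_snoc_snoc, hdxy]
  have hg : L.tdist x < L.g₀ y := by
    have h1 : 2 * L.r₁ y ≤ L.Gp 0 y := two_r₁_le (L := L) y H.M_pos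
    have h2 : L.Gp 0 y ≤ L.g₀ y := by
      unfold g₀
      have h := Gp_le (L := L) y 0 (t := L.ψ 0 y) ⟨le_rfl, (H.ψ_lt y hy 0 H.M_pos).le⟩
      rw [H.ψ_zero y hy] at h
      exact h
    linarith [r₁_pos H hy, hx.2.2.2.1]
  have hγ : dist (L.γ y) t < L.g₀ y := by
    rw [Real.dist_eq, abs_of_nonneg (by linarith [ht.2])]
    have h := hx.2.2.2.2.1
    rw [abs_lt] at h
    linarith [ht.1, h.1, h.2]
  exact max_lt hg hγ

/-- **The top end bit is certified on `U_B`.** [cite: Pawlucki2024, p. 3872] -/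
theorem snoc_mem_V_top {x : Fin m → ℝ} (hx : x ∈ L.UB) {t : ℝ} (ht : t ∈ Ico (L.cut L.M x) (L.δ x)) :
    (Fin.snoc x t : Fin (m + 1) → ℝ) ∈ L.V (L.jb (L.M - 1)) := by
  have hxC := hx.1
  have hy : L.proj x ∈ L.B := ChartData.proj_mem H.toHyp hxC
  set y := L.proj x with hy_def
  have hdxy : dist y x = L.tdist x := by unfold ChartData.tdist; rw [dist_comm]
  rw [cut_eq_of_mem_UB H hx L.M, ψ_M H hy] at ht
  refine mem_V_of_dist_lt (L := L) (z := Fin.snoc y (L.δ y)) ?_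
  rw [dist_snoc_snoc, hdxy]
  have hM1 : L.M - 1 < L.M := Nat.sub_lt H.M_pos one_pos
  have hg : L.tdist x < L.gM y := by
    have h1 : 2 * L.r₁ y ≤ L.Gp (L.M - 1) y := two_r₁_le (L := L) y hM1
    have h2 : L.Gp (L.M - 1) y ≤ L.gM y := by
      unfold gM
      have hle : L.ψ (L.M - 1) y ≤ L.ψ (L.M - 1 + 1) y := (H.ψ_lt y hy _ hM1).le
      have h := Gp_le (L := L) y (L.M - 1) (t := L.ψ (L.M - 1 + 1) y) ⟨hle, le_rfl⟩
      rw [M_sub_add H, ψ_M H hy] at h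
      exact h
    linarith [r₁_pos H hy, hx.2.2.2.1]
  have hδ : dist (L.δ y) t < L.gM y := by
    rw [Real.dist_eq, abs_of_nonpos (by linarith [ht.1])]
    have h := hx.2.2.2.2.2
    rw [abs_lt] at h
    linarith [ht.2, h.1, h.2]
  exact max_lt hg hδ

/-- **The ladder certificates are good.** [cite: Pawlucki2024, p. 3872] -/
theorem certs_good {κ : Cert m q} (hκ : κ ∈ L.certs) : κ.Good L.V := by
  rcases hκ with rfl | rfl | ⟨ν, hν, rfl⟩
  · exact ⟨isOpen_UB H, fun x hx t ht => snoc_mem_V_bot H hx ⟨ht.1, ht.2.le⟩⟩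
  · exact ⟨isOpen_UB H, fun x hx t ht => snoc_mem_V_top H hx ⟨ht.1.le, ht.2⟩⟩
  · exact ⟨isOpen_UB H, fun x hx t ht => snoc_mem_V_mid H hν hx ⟨ht.1.le, ht.2.le⟩⟩

/-- **Certified validity of the translated ladder on `U_B`.** [cite: Pawlucki2024, p. 3872] -/
theorem cvalid_of_mem_UB (𝒞 : Finset ((Fin m → ℝ) → ℝ)) (h𝒞 : ∀ ν ≤ L.M, L.cut ν ∈ 𝒞) {𝒦 : Set (Cert m q)}
    (h𝒦 : L.certs ⊆ 𝒦) {x : Fin m → ℝ} (hx : x ∈ L.UB) : CValid L.γ L.δ 𝒞 𝒦 x := by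
  classical
  have hxC := hx.1
  have hy : L.proj x ∈ L.B := ChartData.proj_mem H.toHyp hxC
  set y := L.proj x with hy_def
  have hcut : ∀ ν, L.cut ν x = L.ψ ν y := fun ν => cut_eq_of_mem_UB H hx ν
  refine cvalid_of_forall fun u v hu hv hlt hcons => ?_
  -- every ladder value avoids `(u, v)`
  have havoid : ∀ ν ≤ L.M, L.ψ ν y ≤ u ∨ v ≤ L.ψ ν y := by
    intro ν hν
    by_cases h1 : L.γ x < L.ψ ν y
    · by_cases h2 : L.ψ ν y < L.δ x
      · have hmem : L.ψ ν y ∈ rcCutVals L.γ L.δ 𝒞 x := by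
          rw [← hcut ν]
          exact mem_rcCutVals_of_mem (h𝒞 ν hν) (by rw [hcut]; exact h1) (by rw [hcut]; exact h2)
        exact hcons _ hmem
      · exact Or.inr (hv.trans (not_lt.1 h2))
    · exact Or.inl ((not_lt.1 h1).trans hu)
  by_cases hA : v ≤ L.ψ 0 y
  · -- bottom end bit
    refine ⟨L.certBot, h𝒦 (Or.inl rfl), hx, hu, ?_⟩
    show v ≤ L.cut 0 x
    rw [hcut]; exact hA
  · have h0 : L.ψ 0 y ≤ u := by
      rcases havoid 0 (Nat.zero_le _) with h | h
      · exact h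
      · exact absurd (h.trans_lt (not_le.1 hA)) (lt_irrefl _)
    set ν₀ := Nat.findGreatest (fun ν => L.ψ ν y ≤ u) L.M with hν₀
    have hν₀le : ν₀ ≤ L.M := Nat.findGreatest_le _
    have hPν₀ : L.ψ ν₀ y ≤ u :=
      Nat.findGreatest_spec (P := fun ν => L.ψ ν y ≤ u) (m := 0) (Nat.zero_le _) h0
    rcases eq_or_lt_of_le hν₀le with heq | hlt'
    · -- top end bit
      refine ⟨L.certTop, h𝒦 (Or.inr (Or.inl rfl)), hx, ?_, hv⟩
      show L.cut L.M x ≤ u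
      rw [hcut, ← heq]; exact hPν₀
    · -- a middle piece
      have hnext : v ≤ L.ψ (ν₀ + 1) y := by
        rcases havoid (ν₀ + 1) hlt' with h | h
        · exact absurd h (Nat.findGreatest_is_greatest (Nat.lt_succ_self ν₀) hlt')
        · exact h
      refine ⟨L.certMid ν₀, h𝒦 (Or.inr (Or.inr ⟨ν₀, hlt', rfl⟩)), hx, ?_, ?_⟩
      · show L.cut ν₀ x ≤ u
        rw [hcut]; exact hPν₀
      · show v ≤ L.cut (ν₀ + 1) x
        rw [hcut]; exact hnext

variable (S : L.SA)
include S

open Classical in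
/-- **The thick-ladder construction, certified** [Pawlucki2024, p. 3872]: cuts `c_0, …, c_M`,
the open semialgebraic `U ⊇ K`, and finitely many good certificates with semialgebraic domains and
endpoints among `γ, δ, c_ν`, certifying the cuts on `U`. [cite: Pawlucki2024, Prop. 2.5 (proof, Part II)] -/
theorem exists_thick_certs :
    ∃ (c : Fin (L.M + 1) → (Fin m → ℝ) → ℝ) (U : Set (Fin m → ℝ)) (𝒦 : Set (Cert m q)),
      (∀ i, Continuous (c i)) ∧ (∀ i, IsSemialgebraicFunOn ℝ univ (c i)) ∧ IsOpen U ∧ IsSemialgebraic ℝ U ∧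
      L.K ⊆ U ∧ 𝒦.Finite ∧ (∀ κ ∈ 𝒦, κ.Good L.V ∧ IsSemialgebraic ℝ κ.O ∧
        (κ.lo = L.γ ∨ κ.lo = L.δ ∨ ∃ i, κ.lo = c i) ∧ (κ.hi = L.γ ∨ κ.hi = L.δ ∨ ∃ i, κ.hi = c i)) ∧
      ∀ x ∈ U, CValid L.γ L.δ (Finset.univ.image c) 𝒦 x := by
  refine ⟨fun i => L.cut i, L.UB, L.certs, fun i => continuous_cut H i, fun i => cut_sa H S i, isOpen_UB H,
    UB_sa H S, K_subset_UB H, certs_finite, fun κ hκ => ⟨certs_good H hκ, ?_, ?_, ?_⟩,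
    fun x hx => cvalid_of_mem_UB H _ (fun ν hν => ?_) subset_rfl hx⟩
  · rcases hκ with rfl | rfl | ⟨ν, hν, rfl⟩ <;> exact UB_sa H S
  · rcases hκ with rfl | rfl | ⟨ν, hν, rfl⟩
    · exact Or.inl rfl
    · exact Or.inr (Or.inr ⟨⟨L.M, Nat.lt_succ_self _⟩, rfl⟩)
    · exact Or.inr (Or.inr ⟨⟨ν, Nat.lt_succ_of_lt hν⟩, rfl⟩)
  · rcases hκ with rfl | rfl | ⟨ν, hν, rfl⟩
    · exact Or.inr (Or.inr ⟨⟨0, Nat.succ_pos _⟩, rfl⟩)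
    · exact Or.inr (Or.inl rfl)
    · exact Or.inr (Or.inr ⟨⟨ν + 1, Nat.succ_lt_succ hν⟩, rfl⟩)
  · exact Finset.mem_image.2 ⟨⟨ν, Nat.lt_succ_of_le hν⟩, Finset.mem_univ _, rfl⟩

end LadderData

end LadderCerts

/-! ### Lens certificates and the certified assembly -/

section LensCerts

variable {m q : ℕ}

namespace LensFamilies

variable {F : LensFamilies m q} (H : F.Hyp)
include H

/-- The certificate of a bottom lens. [cite: Pawlucki2024, Prop. 2.5 (proof, Part I)] -/
def certB (F : LensFamilies m q) (i : Fin F.Ib) : Cert m q := ⟨F.bm i, F.bp i, F.jbI i, univ⟩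

/-- The certificate of a top lens. [cite: Pawlucki2024, Prop. 2.5 (proof, Part I)] -/
def certT (F : LensFamilies m q) (i : Fin F.It) : Cert m q := ⟨F.tm i, F.tp i, F.jtI i, univ⟩

/-- The lens certificates. [cite: Pawlucki2024, Prop. 2.5] -/
def lensCerts (F : LensFamilies m q) : Set (Cert m q) := range F.certB ∪ range F.certT

omit H in
/-- Finitely many lens certificates. [cite: Pawlucki2024, Prop. 2.5] -/
theorem lensCerts_finite : F.lensCerts.Finite := (finite_range _).union (finite_range _)

/-- **Lens certificates are good.** [cite: Pawlucki2024, Prop. 2.5 (proof, Part I)] -/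
theorem lensCerts_good {κ : Cert m q} (hκ : κ ∈ F.lensCerts) : κ.Good F.V := by
  rcases hκ with ⟨i, rfl⟩ | ⟨i, rfl⟩
  · exact ⟨isOpen_univ, fun x _ t ht => H.L1b i x t ht.1 ht.2.le⟩
  · exact ⟨isOpen_univ, fun x _ t ht => H.L1t i x t ht.1.le ht.2⟩

omit H in
/-- Covered pieces are certified by a lens certificate. [cite: Pawlucki2024, p. 3871] -/
theorem exists_lensCert_of_covered {k : ℕ} {x : Fin m → ℝ} (h : F.Covered k x) :
    ∃ κ ∈ F.lensCerts, x ∈ κ.O ∧ κ.lo x ≤ F.α k x ∧ F.α (k + 1) x ≤ κ.hi x := by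
  rcases h with ⟨i, h1, h2⟩ | ⟨i, h1, h2⟩
  · exact ⟨F.certB i, Or.inl ⟨i, rfl⟩, mem_univ _, h1, h2⟩
  · exact ⟨F.certT i, Or.inr ⟨i, rfl⟩, mem_univ _, h1, h2⟩

/-- **Certified assembly** [Pawlucki2024, Prop. 2.5, end of proof]: lens certificates plus certified
validity on every free window give certified validity on the whole capsule at every point of `D`.
[cite: Pawlucki2024, Prop. 2.5 (proof, Part II)] -/
theorem cvalid_of_free (𝒞 : Finset ((Fin m → ℝ) → ℝ)) (hcuts : ∀ j, F.cuts j ∈ 𝒞) {𝒦 : Set (Cert m q)}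
    (h𝒦 : F.lensCerts ⊆ 𝒦) (hfree : ∀ k ≤ F.N, ∀ x ∈ F.Free k, CValid (F.α k) (F.α (k + 1)) 𝒞 𝒦 x)
    {x : Fin m → ℝ} (hx : x ∈ F.D) : CValid F.a F.b 𝒞 𝒦 x := by
  classical
  refine cvalid_of_forall fun u v hu hv hlt hcons => ?_
  have havoid : ∀ k, F.α k x ≤ u ∨ v ≤ F.α k x := by
    intro k
    by_cases hk : k < F.N + 2
    · obtain ⟨i, hi⟩ := exists_rcLaminar_eq (a := F.a) (b := F.b) (c := F.cuts) (x := x) hk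
      have h := rcFamily_notMem_Ioo_of_cons (F := F) hcuts hu hv hcons i
      rw [← hi] at h
      rw [mem_Ioo, not_and_or, not_lt, not_lt] at h
      exact h
    · right
      have : F.α k x = F.b x := α_last H hx (by omega)
      rw [this]; exact hv
  set k₀ := Nat.findGreatest (fun k => F.α k x ≤ u) (F.N + 1) with hk₀
  have hk₀le : k₀ ≤ F.N + 1 := Nat.findGreatest_le _
  have h0 : F.α 0 x ≤ u := by rw [α_zero H hx]; exact hu
  have hPk₀ : F.α k₀ x ≤ u := Nat.findGreatest_spec (P := fun k => F.α k x ≤ u) (m := 0) (Nat.zero_le _) h0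
  have hk₀N : k₀ ≤ F.N := by
    by_contra hgt
    have : F.α k₀ x = F.b x := α_last H hx (by omega)
    rw [this] at hPk₀
    exact absurd (hlt.trans_le hv) (not_lt.2 hPk₀)
  have hnext : v ≤ F.α (k₀ + 1) x := by
    rcases havoid (k₀ + 1) with h | h
    · exact absurd h (Nat.findGreatest_is_greatest (Nat.lt_succ_self k₀) (by omega))
    · exact h
  have hgap : F.α k₀ x < F.α (k₀ + 1) x := hPk₀.trans_lt (hlt.trans_le hnext)
  by_cases hcov : F.Covered k₀ x
  · obtain ⟨κ, hκ, hxO, h1, h2⟩ := exists_lensCert_of_covered hcov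
    exact ⟨κ, h𝒦 hκ, hxO, h1.trans hPk₀, hnext.trans h2⟩
  · have hfx : x ∈ F.Free k₀ := ⟨hx, hgap, hcov⟩
    refine (hfree k₀ hk₀N x hfx).cert hPk₀ hnext hlt fun w hw => ?_
    rcases hw with rfl | rfl | ⟨c, hc, rfl, h1, h2⟩
    · exact Or.inl hPk₀
    · exact Or.inr hnext
    · exact hcons _ (mem_rcCutVals_of_mem hc ((α_mem H hx k₀).1.trans_lt h1) (h2.trans_le (α_mem H hx _).2))

end LensFamilies

end LensCerts

end Literature.ModelTheory.ExponentialFields
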